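import Mathlib
import Literature.NumberTheory.LFunctions.Zhang2022.Section4RoucheInnerEdges
import Literature.NumberTheory.LFunctions.Zhang2022.Section4Step4u050
import Literature.Analysis.Complex.RoucheTheorem
import HarnessLib

/-!
# Zhang (2022), §4: the Rouché binder of the Lemma 4.6 / Lemma 4.7 / Prop. 2.2 (iii) edges
# DISCHARGED — FACT F-29 is the tree theorem `Rouche.finsum_analyticOrderNatAt_eq_of_norm_sub_lt`

Topic `Literature/NumberTheory/LFunctions/Zhang2022` (Landau–Siegel audit tree; verdict-neutral).
Y. Zhang, *Discrete mean estimates and the Landau–Siegel zero*, arXiv:2211.02515v1 (2022)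
[Zhang2022LandauSiegel] — **an unrefereed manuscript under adjudication**. The campaign's §4 Rouché
edges (`Section4Lemma46Rouche.lemma46_of_rouche`, `Section4Lemma47Rouche.three_zeros_of_rouche` /
`lemma47_of_rouche`, `Section4Prop22iiiRouche.prop22iii_of_rouche`) carry Rouché's theorem in
exact-count form (FACT-LIST row F-29, Conway V §3 Thm 3.8) as an explicit HYPOTHESIS BINDER phrased
with Mathlib's `analyticOrderNatAt`. Row F-29 is class T now (FACT-LIST ERRATA E-1): the tree's
`Literature/Analysis/Complex/RoucheTheorem.lean` proves
`Rouche.finsum_analyticOrderNatAt_eq_of_norm_sub_lt`, whose type is that binder VERBATIM. Feeding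
it in gives the fact-free edges (DAG `Z22:Lem4.6.pf`, `Z22:Lem4.7`/`Lem4.7.pf`, `Z22:Prop2.2` (iii)):

* `lemma46_of : Lemma42 → Eq412 → ∃ c₀, ∀ c′ > c₀, Lemma46 c′`;
* `three_zeros_of` (the located zeros `0, iα + v₁, −iα + v₋₁` of `𝒜(ρ+·,ψ)`),
  `lemma47_of : Lemma42 → Eq412 → ∃ c₀, ∀ c′ ≥ c₀, Lemma47 c′`;
* `prop22iii_of : Lemma42 → Eq412 → Prop22i → ∃ c₀, ∀ c′ ≥ c₀, Prop22iii c′`.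

And, through `Section4RoucheInner`/`…InnerEdges` and the tree's `Section4.eq412_inner_of` ((4.12)
on `Re w > −α` from Lemmas 4.2–4.3, (4.6), (4.10) on `Ω₃`): `three_zeros_of_eq410`,
`lemma47_of_eq410 : Lemma42 → Lemma43 → Eq46 → Eq410 → ∃ c₀, ∀ c′ ≥ c₀, Lemma47 c′`,
`prop22iii_of_eq410 : … → Prop22i → ∃ c₀, ∀ c′ ≥ c₀, Prop22iii c′` — no fact hypothesis and no use
of (4.10) outside `Ω₃`. The remaining hypotheses (`Lemma42`, `Lemma43`, `Eq46`, `Eq410`, `Eq412`,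
`Prop22i`) are CLAIM nodes of the manuscript, not facts. Nothing about Theorems 1–2 of the source is stated or
implied; nothing here bears on the cell's verdict on (8.24).

## References

* Y. Zhang, arXiv:2211.02515v1 (2022), §4 pp. 22–23 (Lemmas 4.6, 4.7), §2 p. 5 (Prop. 2.2 (iii)).
  [cite: Zhang2022LandauSiegel, §4 Lemmas 4.6–4.7; §2 Prop. 2.2 (iii)]
* J. B. Conway, *Functions of One Complex Variable I* (1978), Ch. V §3 Thm 3.8 (Rouché), via the
  tree's `Literature/Analysis/Complex/RoucheTheorem.lean`. [cite: Conway1978, Ch. V §3 Thm 3.8]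
-/

noncomputable section

open Complex Real Set Filter Topology

namespace Literature.NumberTheory.LFunctions.Zhang2022.Section4

open Literature.NumberTheory.LFunctions.Zhang2022.Skeleton

/-- **Lemma 4.6 from Lemma 4.2 and (4.12)** (`Z22:Lem4.6` + `Z22:Lem4.6.pf`), for every sufficiently
large `c′`, NO fact hypothesis: `Section4Lemma46Rouche.lemma46_of_rouche` with Rouché's theorem
supplied by the tree (`Literature/Analysis/Complex/RoucheTheorem.lean`).
[cite: Zhang2022LandauSiegel, §4 Lemma 4.6] -/
theorem lemma46_of (h42 : Lemma42) (h412 : Eq412) : ∃ c₀ : ℝ, ∀ c' : ℝ, c₀ < c' → Lemma46 c' :=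
  lemma46_of_rouche Literature.Analysis.Complex.Rouche.finsum_analyticOrderNatAt_eq_of_norm_sub_lt
    h42 h412

/-- **The three located zeros of `𝒜(ρ+·,ψ)`**, NO fact hypothesis (`three_zeros_of_rouche` with the
tree's Rouché theorem). [cite: Zhang2022LandauSiegel, §4 Lemma 4.7 (proof)] -/
theorem three_zeros_of (h42 : Lemma42) (h412 : Eq412) : ∃ c₀ : ℝ, ∀ c' : ℝ, c₀ ≤ c' →
    ForAllLarge fun D _ χ => ∀ x ∈ PsiOne χ, ∀ ρ : ℂ, calA χ x ρ = 0 → ρ.re = 1 / 2 →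
      |ρ.im - 2 * π * t0 D| < ell1 D + 2 →
        ∃ v₁ vm : ℂ, ‖v₁‖ < c' * alpha D ^ 2 * ell D ∧ ‖vm‖ < c' * alpha D ^ 2 * ell D ∧
          {w : ℂ | ‖w‖ < alpha D * (1 + c' * alpha D * ell D) ∧ calA χ x (ρ + w) = 0} =
            {(0 : ℂ), I * (alpha D : ℂ) + v₁, -(I * (alpha D : ℂ)) + vm} :=
  three_zeros_of_rouche
    Literature.Analysis.Complex.Rouche.finsum_analyticOrderNatAt_eq_of_norm_sub_lt h42 h412

/-- **Lemma 4.7 from Lemma 4.2 and (4.12)** (`Z22:Lem4.7` + `Z22:Lem4.7.pf`), for every sufficiently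
large `c′`, NO fact hypothesis: the node `Skeleton.Lemma47 c′`.
[cite: Zhang2022LandauSiegel, §4 Lemma 4.7] -/
theorem lemma47_of (h42 : Lemma42) (h412 : Eq412) : ∃ c₀ : ℝ, ∀ c' : ℝ, c₀ ≤ c' → Lemma47 c' :=
  lemma47_of_rouche
    Literature.Analysis.Complex.Rouche.finsum_analyticOrderNatAt_eq_of_norm_sub_lt h42 h412


/-- **Proposition 2.2 (iii) from Lemma 4.2, (4.12) and Proposition 2.2 (i)** (`Z22:Prop2.2` (iii)),
for every sufficiently large `c′`, NO fact hypothesis: the node `Skeleton.Prop22iii c′`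
(`prop22iii_of_rouche` with the tree's Rouché theorem). [cite: Zhang2022LandauSiegel, §2 Prop. 2.2 (iii)] -/
theorem prop22iii_of (h42 : Lemma42) (h412 : Eq412) (hi : Prop22i) :
    ∃ c₀ : ℝ, ∀ c' : ℝ, c₀ ≤ c' → Prop22iii c' :=
  prop22iii_of_rouche
    Literature.Analysis.Complex.Rouche.finsum_analyticOrderNatAt_eq_of_norm_sub_lt h42 h412 hi

/-! ## From (4.10) on `Ω₃` (no wide-strip (4.10) needed): the half-disc (4.12) of `eq412_inner_of` -/

/-- **The three located zeros of `𝒜(ρ+·,ψ)` from Lemma 4.2, Lemma 4.3, (4.6) and (4.10)**, NO fact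
hypothesis (`three_zeros_of_rouche_inner` + `Section4.eq412_inner_of` + the tree's Rouché theorem).
[cite: Zhang2022LandauSiegel, §4 Lemma 4.7 (proof)] -/
theorem three_zeros_of_eq410 (h42 : Lemma42) (h43 : Lemma43) (h46 : Eq46) (h410 : Eq410) :
    ∃ c₀ : ℝ, ∀ c' : ℝ, c₀ ≤ c' →
    ForAllLarge fun D _ χ => ∀ x ∈ PsiOne χ, ∀ ρ : ℂ, calA χ x ρ = 0 → ρ.re = 1 / 2 →
      |ρ.im - 2 * π * t0 D| < ell1 D + 2 →
        ∃ v₁ vm : ℂ, ‖v₁‖ < c' * alpha D ^ 2 * ell D ∧ ‖vm‖ < c' * alpha D ^ 2 * ell D ∧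
          {w : ℂ | ‖w‖ < alpha D * (1 + c' * alpha D * ell D) ∧ calA χ x (ρ + w) = 0} =
            {(0 : ℂ), I * (alpha D : ℂ) + v₁, -(I * (alpha D : ℂ)) + vm} :=
  three_zeros_of_rouche_inner
    Literature.Analysis.Complex.Rouche.finsum_analyticOrderNatAt_eq_of_norm_sub_lt h42
    (eq412_inner_of h42 h43 h46 h410)

/-- **Lemma 4.7 from Lemma 4.2, Lemma 4.3, (4.6) and (4.10) on `Ω₃`** (`Z22:Lem4.7` + `Z22:Lem4.7.pf`),
for every sufficiently large `c′`, NO fact hypothesis and no use of (4.10) outside `Ω₃` (GAP row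
G-L1t7-1 immaterial here). [cite: Zhang2022LandauSiegel, §4 Lemma 4.7] -/
theorem lemma47_of_eq410 (h42 : Lemma42) (h43 : Lemma43) (h46 : Eq46) (h410 : Eq410) :
    ∃ c₀ : ℝ, ∀ c' : ℝ, c₀ ≤ c' → Lemma47 c' :=
  lemma47_of_rouche_inner
    Literature.Analysis.Complex.Rouche.finsum_analyticOrderNatAt_eq_of_norm_sub_lt h42
    (eq412_inner_of h42 h43 h46 h410)

/-- **Proposition 2.2 (iii) from Lemma 4.2, Lemma 4.3, (4.6), (4.10) on `Ω₃` and Prop. 2.2 (i)**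
(`Z22:Prop2.2` (iii)), for every sufficiently large `c′`, NO fact hypothesis.
[cite: Zhang2022LandauSiegel, §2 Prop. 2.2 (iii)] -/
theorem prop22iii_of_eq410 (h42 : Lemma42) (h43 : Lemma43) (h46 : Eq46) (h410 : Eq410)
    (hi : Prop22i) : ∃ c₀ : ℝ, ∀ c' : ℝ, c₀ ≤ c' → Prop22iii c' :=
  prop22iii_of_rouche_inner
    Literature.Analysis.Complex.Rouche.finsum_analyticOrderNatAt_eq_of_norm_sub_lt h42
    (eq412_inner_of h42 h43 h46 h410) hi

end Literature.NumberTheory.LFunctions.Zhang2022.Section4
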